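import Mathlib
import Summits.CriticalPhenomena.Ising3DConformalLimit.Theorems.PrecisionLaplacianInverseMFerromagnetLevelLeOne
import Summits.CriticalPhenomena.Ising3DConformalLimit.Theorems.PrecisionLaplacianInverseMFerromagnetImNonadjOfLaw2Aux
import HarnessLib

/-!
# Crux `PrecisionLaplacian.InverseMFerromagnet` (stmt-CriticalPhenomena-4798), line `Sketch` —
# stub `helper_sp_base` (T-SP·0, the base of the series–parallel induction)

THEOREM-ONLY helper file (no definitions).  DB♯ — the dressed edge bound
`(Σ⁻¹)_xy ≤ −t/(1 + t² − 2 t G_xy)` with `t = tanh (total coupling on {x,y})`,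
`G_xy = ⟨σ_xσ_y⟩` — for a structure with NO bonds (`m = 0`): every spin is free, so
`Σ_pq = ⟨σ_pσ_q⟩ = δ_pq` (`c2_free` off the diagonal, `gksExpect_pair_self` on it), hence
`Σ = 1 = Σ⁻¹` has vanishing off-diagonal entries, while the right-hand side is
`−tanh 0 / (1 + tanh² 0 − 0) = 0` (the coupling sum over `Fin 0` is empty).
-/

namespace Summit.CriticalPhenomena.Ising3DConformalLimit.Cruxes.InverseMFerromagnet.PartialCovarianceLadder

open Literature.Probability.LatticeModels Finset Matrix

noncomputable section

/-- With no bonds the spin second-moment matrix is the identity, `⟨σ_pσ_q⟩ = δ_pq`: the diagonal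
is `σ_p² = 1`, and for `p ≠ q` the spin `p` is free, so `⟨σ_pσ_q⟩ = 0` by the flip of `p`. [folklore] -/
theorem spBase_matrix_eq_one (n : ℕ) (K : Fin 0 → ℝ) (C : Fin 0 → Finset (Fin n)) :
    (Matrix.of fun p q : Fin n => gksExpect Finset.univ K C (fun ω => spinAt p ω * spinAt q ω))
      = 1 := by
  ext p q
  by_cases hpq : p = q
  · subst hpq
    rw [Matrix.of_apply, Matrix.one_apply_eq]
    exact gksExpect_pair_self n 0 K C p
  · rw [Matrix.of_apply, Matrix.one_apply_ne hpq]
    exact c2_free K C p (fun i => i.elim0) (fun ω => spinAt q ω)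
      (fun ω => pcm2im_spinAt_flip_ne (Ne.symm hpq) ω)

/-- **T-SP·0 (base).**  A bondless structure satisfies DB♯: `Σ = 1`, so `Σ⁻¹ = 1` has vanishing
off-diagonal entries, and the bound is `0` (empty coupling sum). [folklore] -/
theorem helper_sp_base :
    ∀ (n m : ℕ) (K : Fin m → ℝ) (C : Fin m → Finset (Fin n)), m = 0 → ∀ x y : Fin n, x ≠ y →
        (Matrix.of fun p q : Fin n => gksExpect Finset.univ K C (fun ω => spinAt p ω * spinAt q ω))⁻¹ x y ≤
          -(Real.tanh (∑ i ∈ Finset.univ.filter (fun i => C i = {x, y}), K i)) /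
            (1 + Real.tanh (∑ i ∈ Finset.univ.filter (fun i => C i = {x, y}), K i) ^ 2
              - 2 * Real.tanh (∑ i ∈ Finset.univ.filter (fun i => C i = {x, y}), K i)
                * gksExpect Finset.univ K C (fun ω => spinAt x ω * spinAt y ω)) := by
  intro n m K C hm x y hxy
  subst hm
  rw [spBase_matrix_eq_one n K C, inv_one, Matrix.one_apply_ne hxy]
  have h0 : ∑ i ∈ Finset.univ.filter (fun i => C i = {x, y}), K i = 0 :=
    Finset.sum_eq_zero fun i _ => i.elim0
  rw [h0, Real.tanh_zero]
  simp

end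

end Summit.CriticalPhenomena.Ising3DConformalLimit.Cruxes.InverseMFerromagnet.PartialCovarianceLadder
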